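import Summits.QuantumFields.YangMills.Theorems.BalabanUVNodesN19OscillatingLinksMomentDiscrepancy

/-!
# YM-DAG node N19 (= NE7 proper) — MULTISCALE TELESCOPING, PART 7: THE PERIODIC ZIGZAGS AT A PRESCRIBED DEGREE BUDGET —
# `dist_∞(dist(Σ_{i≤d}|x_i|, Pℤ), Π_t) ≤ 100·d·log₂t·(log₂t + 21)∕t` for ALL `t ≥ 256` and EVERY period `0 < P ≤ 2d`, and its law-level face

Cell `pub-ymgap`, HUMAN RULING D-0062 (Track A) ∕ D-0149 (work-bound push), R141 (C) wider-strategy seat `pub-ymgap-dag-n19-e` (strategy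
s3 = ALTERNATIVE CURRENCY), generation g30, module 9 (lineage module 126).  Route `Summits/QuantumFields/YangMills/Theses/BalabanUVNodes.lean`,
cluster item K3⁸ «SpineGivenEndpointR13SepCoPHV» (stmt-QuantumFields-27366); filed `--supports` that item `--as helper` (it proves no registered
stub).  COUNT-NEUTRAL: [folklore] over Mathlib and the lineage BY NAME — PART 3 `…N19OscillatingLinksMultiscale` (`exists_mvPolynomial_near_zigzag_l1Norm`,
`abs_zigzag_sub_quarter_le`, `continuous` bookkeeping), PART 2b (`exists_dyadicBudget`, `dyadicBudget_bounds`), PART 6 `…N19OscillatingLinksMomentDiscrepancy`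
(`abs_integral_sub_integral_le_of_near`, `continuous_l1Norm`); TOY laws under HYPOTHESES in §2; no scheme object, no Theses import; NOT a discharge claim.

CONTENT.  PART 3 priced the zigzag `h_P∘S_d = dist(Σ_i|x_i|, Pℤ)` parametrically (`J`, `N`).  §1 ★★★ `exists_mvPolynomial_near_zigzag_l1Norm_degree`: for
ALL `t ≥ 256` and every period `0 < P ≤ 2d` an `MvPolynomial` of total degree `≤ t` within `100·d·log₂t·(log₂t + 21)∕t` of `(P∕2π)·arccos(cos(2πS_d∕P))` on
`[−1,1]^d` (the dyadic `J` of PART 2b; `N = ⌊2^{J+2}P∕(600πd)⌋`; if `N ≥ 1` PART 3's zigzag theorem with `600πNd∕P ≤ 2^{J+2}`, `P∕(2π²N) ≤ 150d∕(π2^J)`,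
`log N ≤ J + 2`; if `N = 0` the period is below `600πd∕2^{J+2}` and the CONSTANT `P∕4` is within `P∕4 < 600π·d·(J+2)∕t`).  §2 ★★
`abs_integral_zigzag_l1Norm_sub_le_of_moments`: probability laws on the cube with equal mixed moments of total degree `≤ t` integrate every such zigzag of
the ℓ¹-norm to within `200·d·log₂t·(log₂t + 21)∕t`.
READING for (v′) (honest): the zigzag links — the numerically EXTREMAL family of HOME `numerics/` (critical period `P ≈ 5d∕t`, supremum over links `= d ×`
the one-string value) — cost `≤ 100·d·log₂t·(log₂t + 21)∕t` at EVERY period `P ≤ 2d` (larger periods make `h_P∘S_d = S_d`, the additive class): the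
conjectured `Θ(d∕t)` up to `log²t`, uniformly in the period.  (v′) for GENERAL Lipschitz links stays OPEN.

HONEST FRAMING (binding).  Elementary and [folklore]; ONE-SIDED (upper bounds); NO consumer in the DAG today (an optimality map of the seat's own
currency, degree model); nothing of Bałaban's instantiated; NE7 NOT PRINTED, NOT proved; N19 NOT discharged; count-neutral.  One finite `T⁴` programme
at fixed `ε`; nothing continuum ∕ `ℝ⁴` ∕ OS ∕ mass-gap ∕ Clay.  0 `def` ∕ 0 `sorry`.
-/

noncomputable section

open Real Finset MeasureTheory

namespace Summit.QuantumFields.YangMills.Theorems.BalabanUVNodesN19ZigzagLinksDegreeBudget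

open Summit.QuantumFields.YangMills.Theorems.BalabanUVNodesN19OscillatingLinksMultiscale
  (exists_mvPolynomial_near_zigzag_l1Norm abs_zigzag_sub_quarter_le)
open Summit.QuantumFields.YangMills.Theorems.BalabanUVNodesN19SingleModeDegreeBudget (exists_dyadicBudget dyadicBudget_bounds)
open Summit.QuantumFields.YangMills.Theorems.BalabanUVNodesN19OscillatingLinksMomentDiscrepancy
  (abs_integral_sub_integral_le_of_near continuous_l1Norm)

variable {ι : Type*} [Fintype ι]

/-! ## §1 ★★★ The zigzags at degree `t` [folklore] -/

/-- ★★★ **THE PERIODIC ZIGZAGS AT DEGREE `t`: `dist_∞(dist(Σ_{i≤d}|x_i|, Pℤ), Π_t) ≤ 100·d·log₂t·(log₂t + 21)∕t`** for all `t ≥ 256`, every period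
`0 < P ≤ 2d` (`d = |ι|`; the zigzag written as `(P∕2π)·arccos(cos(2πs∕P)) = dist(s, Pℤ)`).  With the dyadic `J` of PART 2b and `N = ⌊2^{J+2}P∕(600πd)⌋`:
if `N ≥ 1`, PART 3's zigzag polynomial (degree `(J+1)(2^{J+2} + 600πNd∕P) ≤ (J+1)2^{J+3} ≤ t`, error `P∕(2π²N) + (P(J+1)∕4 + (16d∕π)(1+log N))∕2^J ≤
d(6J + 64)∕2^J ≤ d(6J + 120)∕2^J ≤ 16(J+2)d(6J+120)∕t`); if `N = 0`, the constant `P∕4 < 150πd∕2^{J+2} ≤ 120d∕2^J`. [folklore] -/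
theorem exists_mvPolynomial_near_zigzag_l1Norm_degree {t : ℕ} (ht : 256 ≤ t) {P : ℝ} (hP : 0 < P) (hP2 : P ≤ 2 * Fintype.card ι) :
    ∃ Q : MvPolynomial ι ℝ, Q.totalDegree ≤ t ∧
      ∀ x : ι → ℝ, (∀ i, x i ∈ Set.Icc (-1 : ℝ) 1) →
        |P / (2 * π) * Real.arccos (Real.cos (2 * π * (∑ i, |x i|) / P)) - MvPolynomial.eval x Q| ≤
          100 * Fintype.card ι * Real.logb 2 t * (Real.logb 2 t + 21) / t := by
  set d : ℝ := (Fintype.card ι : ℝ) with hd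
  have hd0 : 0 ≤ d := Nat.cast_nonneg _
  have hdpos : 0 < d := by linarith
  have hπ := Real.pi_pos
  have hπ3 : π ≤ 3.15 := Real.pi_lt_d2.le
  obtain ⟨J, h1, h2⟩ := exists_dyadicBudget (le_trans (by norm_num) ht)
  obtain ⟨hinv, hlog, htle, hlog3⟩ := dyadicBudget_bounds h1 h2
  set L : ℝ := Real.logb 2 t with hL
  have ht0 : (0 : ℝ) < t := by exact_mod_cast lt_of_lt_of_le (by norm_num) ht
  have hJ0 : (0 : ℝ) ≤ J := Nat.cast_nonneg _
  -- `L ≥ 8`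
  have hL8 : (8 : ℝ) ≤ L := by
    rw [hL, Real.le_logb_iff_rpow_le one_lt_two ht0]
    have : (2 : ℝ) ^ (8 : ℝ) = ((2 ^ 8 : ℕ) : ℝ) := by
      rw [show (8 : ℝ) = ((8 : ℕ) : ℝ) by norm_num, Real.rpow_natCast]; push_cast; ring
    rw [this]; exact_mod_cast ht
  have hL0 : 0 ≤ L := by linarith
  have h2J : (0 : ℝ) < 2 ^ J := by positivity
  -- the number of modes
  obtain ⟨N, hN⟩ : ∃ N : ℕ, N = ⌊(2 : ℝ) ^ (J + 2) * P / (600 * π * d)⌋₊ := ⟨_, rfl⟩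
  have hNle : (N : ℝ) ≤ 2 ^ (J + 2) * P / (600 * π * d) := by rw [hN]; exact Nat.floor_le (by positivity)
  have hNlt : (2 : ℝ) ^ (J + 2) * P / (600 * π * d) < N + 1 := by rw [hN]; exact Nat.lt_floor_add_one _
  clear hN
  -- the common final bound
  have hfinal : ∀ E : ℝ, E ≤ d * (6 * J + 120) * (1 / 2 ^ J) → E ≤ 100 * d * L * (L + 21) / t := by
    intro E hE
    refine hE.trans ?_
    have hJL : (J : ℝ) + 2 ≤ L := by linarith only [hlog]
    have h6 : (6 : ℝ) * J + 120 ≤ 6 * (L + 21) := by linarith only [hlog]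
    calc d * (6 * J + 120) * (1 / 2 ^ J) ≤ d * (6 * J + 120) * (16 * ((J : ℝ) + 2) / t) :=
          mul_le_mul_of_nonneg_left hinv (by positivity)
      _ = 16 * d * (((J : ℝ) + 2) * (6 * J + 120)) / t := by ring
      _ ≤ 16 * d * (L * (6 * (L + 21))) / t := by
          refine div_le_div_of_nonneg_right (mul_le_mul_of_nonneg_left ?_ (by positivity)) ht0.le
          exact mul_le_mul hJL h6 (by positivity) hL0
      _ = 96 * d * L * (L + 21) / t := by ring
      _ ≤ 100 * d * L * (L + 21) / t := by
          refine div_le_div_of_nonneg_right ?_ ht0.le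
          have : 0 ≤ d * L * (L + 21) := by positivity
          linarith only [this]
  rcases Nat.eq_zero_or_pos N with hN0 | hNpos
  · -- tiny period: the constant `P/4`
    subst hN0
    refine ⟨MvPolynomial.C (P / 4), ?_, fun x hx => hfinal _ ?_⟩
    · rw [MvPolynomial.totalDegree_C]; exact Nat.zero_le _
    · rw [MvPolynomial.eval_C]
      have hsmall : (2 : ℝ) ^ (J + 2) * P / (600 * π * d) < 1 := by simpa using hNlt
      have hP' : P < 600 * π * d / 2 ^ (J + 2) := by
        rw [div_lt_one (by positivity)] at hsmall
        rw [lt_div_iff₀ (by positivity)]; linarith only [hsmall]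
      refine (abs_zigzag_sub_quarter_le hP _).trans ?_
      have e : (2 : ℝ) ^ (J + 2) = 4 * 2 ^ J := by ring
      calc P / 4 ≤ 600 * π * d / 2 ^ (J + 2) / 4 := by linarith only [hP']
        _ = d * (600 * π / 16) * (1 / 2 ^ J) := by rw [e]; field_simp; ring
        _ ≤ d * (6 * J + 120) * (1 / 2 ^ J) := by
            refine mul_le_mul_of_nonneg_right (mul_le_mul_of_nonneg_left ?_ hd0) (by positivity)
            nlinarith only [hπ3, hJ0]
  · -- `N ≥ 1`: PART 3
    have hN1 : 1 ≤ N := hNpos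
    have hN1r : (1 : ℝ) ≤ N := by exact_mod_cast hN1
    obtain ⟨Q, hdeg, herr⟩ := exists_mvPolynomial_near_zigzag_l1Norm (ι := ι) hP J hN1
    refine ⟨Q, ?_, fun x hx => hfinal _ ((herr x hx).trans ?_)⟩
    · -- degree
      have hb : ((J : ℝ) + 1) * (2 ^ (J + 2) + 150 * (4 * π * N / P) * Fintype.card ι) ≤ ((J + 1) * 2 ^ (J + 3) : ℕ) := by
        push_cast
        rw [← hd]
        have h3 : 150 * (4 * π * (N : ℝ) / P) * d ≤ 2 ^ (J + 2) := by
          have := mul_le_mul_of_nonneg_left hNle (by positivity : (0 : ℝ) ≤ 600 * π * d / P)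
          have e1 : 600 * π * d / P * (2 ^ (J + 2) * P / (600 * π * d)) = 2 ^ (J + 2) := by
            field_simp
          rw [e1] at this
          calc 150 * (4 * π * (N : ℝ) / P) * d = 600 * π * d / P * N := by field_simp; ring
            _ ≤ 2 ^ (J + 2) := this
        calc ((J : ℝ) + 1) * (2 ^ (J + 2) + 150 * (4 * π * N / P) * d) ≤ ((J : ℝ) + 1) * (2 ^ (J + 2) + 2 ^ (J + 2)) :=
              mul_le_mul_of_nonneg_left (add_le_add le_rfl h3) (by positivity)
          _ = ((J : ℝ) + 1) * 2 ^ (J + 3) := by ring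
      exact (Nat.cast_le.1 (hdeg.trans hb)).trans h1
    · -- error
      rw [← hd]
      -- `P/(2π²N) ≤ 150 d/(π 2^J)`: from `N ≥ 2^{J+2}P/(1200πd)`
      have hN2 : (2 : ℝ) ^ (J + 2) * P ≤ 1200 * π * d * N := by
        have : (2 : ℝ) ^ (J + 2) * P < 600 * π * d * (N + 1) := by
          rw [div_lt_iff₀ (by positivity)] at hNlt; linarith only [hNlt]
        have hpd : 0 < π * d := mul_pos hπ hdpos
        nlinarith only [this, hN1r, hpd]
      have hA : P / (2 * π ^ 2 * N) ≤ 48 * d * (1 / 2 ^ J) := by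
        rw [div_le_iff₀ (by positivity)]
        have e : (2 : ℝ) ^ (J + 2) = 4 * 2 ^ J := by ring
        rw [e] at hN2
        have h150 : (1200 : ℝ) * π ≤ 48 * (2 * π ^ 2) * 4 := by nlinarith only [Real.pi_gt_d2, hπ]
        -- `P ≤ 1200π d N /(4·2^J) ≤ 48 d (2π²N)·(1/2^J)`
        have hP1 : P ≤ 1200 * π * d * N / (4 * 2 ^ J) := by
          calc P = 4 * 2 ^ J * P / (4 * 2 ^ J) := by field_simp
            _ ≤ 1200 * π * d * N / (4 * 2 ^ J) := div_le_div_of_nonneg_right hN2 (by positivity)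
        calc P ≤ 1200 * π * d * N / (4 * 2 ^ J) := hP1
          _ = (1200 * π) * (d * N) / (4 * 2 ^ J) := by ring
          _ ≤ (48 * (2 * π ^ 2) * 4) * (d * N) / (4 * 2 ^ J) :=
              div_le_div_of_nonneg_right (mul_le_mul_of_nonneg_right h150 (by positivity)) (by positivity)
          _ = 48 * d * (1 / 2 ^ J) * (2 * π ^ 2 * N) := by field_simp
      -- `log N ≤ J + 2`
      have hlogN : Real.log N ≤ (J : ℝ) + 2 := by
        have hNpos' : (0 : ℝ) < N := by linarith only [hN1r]
        have hN3 : (N : ℝ) ≤ 2 ^ (J + 2) := by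
          refine hNle.trans ?_
          rw [div_le_iff₀ (by positivity)]
          have : P ≤ 600 * π * d := by nlinarith only [hP2, Real.pi_gt_three, hd0]
          have h2J2 : (0 : ℝ) < 2 ^ (J + 2) := by positivity
          nlinarith only [this, h2J2]
        have hl2 : Real.log 2 ≤ 1 := by have := Real.log_two_lt_d9; linarith only [this]
        calc Real.log N ≤ Real.log (2 ^ (J + 2)) := Real.log_le_log hNpos' hN3
          _ = ((J + 2 : ℕ) : ℝ) * Real.log 2 := by rw [Real.log_pow]
          _ ≤ ((J + 2 : ℕ) : ℝ) * 1 := mul_le_mul_of_nonneg_left hl2 (Nat.cast_nonneg _)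
          _ = (J : ℝ) + 2 := by push_cast; ring
      have hB : (P * ((J : ℝ) + 1) / 4 + 16 * d / π * (1 + Real.log N)) / 2 ^ J ≤ d * (6 * J + 16) * (1 / 2 ^ J) := by
        rw [div_eq_mul_one_div _ ((2 : ℝ) ^ J)]
        refine mul_le_mul_of_nonneg_right ?_ (by positivity)
        have hlog0 : 0 ≤ 1 + Real.log N := by linarith only [Real.log_nonneg hN1r]
        have h16 : 16 / π ≤ (5.1 : ℝ) := by rw [div_le_iff₀ hπ]; nlinarith only [Real.pi_gt_d2]
        have hx : 16 * d / π * (1 + Real.log N) ≤ 5.1 * d * ((J : ℝ) + 3) := by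
          calc 16 * d / π * (1 + Real.log N) = 16 / π * (d * (1 + Real.log N)) := by ring
            _ ≤ 5.1 * (d * ((J : ℝ) + 3)) := by
                refine mul_le_mul h16 (mul_le_mul_of_nonneg_left (by linarith only [hlogN]) hd0) (by positivity) (by norm_num)
            _ = 5.1 * d * ((J : ℝ) + 3) := by ring
        have hy : P * ((J : ℝ) + 1) / 4 ≤ d * ((J : ℝ) + 1) / 2 := by
          rw [div_le_div_iff₀ (by norm_num) (by norm_num)]
          nlinarith only [hP2, hJ0, hd0]
        nlinarith only [hx, hy, hd0, hJ0]
      calc P / (2 * π ^ 2 * N) + (P * ((J : ℝ) + 1) / 4 + 16 * d / π * (1 + Real.log N)) / 2 ^ J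
          ≤ 48 * d * (1 / 2 ^ J) + d * (6 * J + 16) * (1 / 2 ^ J) := add_le_add hA hB
        _ = d * (6 * J + 64) * (1 / 2 ^ J) := by ring
        _ ≤ d * (6 * J + 120) * (1 / 2 ^ J) := by
            refine mul_le_mul_of_nonneg_right (mul_le_mul_of_nonneg_left (by linarith only [hJ0]) hd0) (by positivity)

/-! ## §2 ★★ The law-level face [folklore] -/

/-- ★★ **ZIGZAGS, LAW LEVEL.**  For probability laws `P₁, P₂` on `ℝ^ι` carried by `[−1,1]^ι` with EQUAL mixed moments of total degree `≤ t` (`t ≥ 256`)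
and every period `0 < P ≤ 2d`: `|∫dist(Σ_i|x_i|, Pℤ)dP₁ − ∫dist(Σ_i|x_i|, Pℤ)dP₂| ≤ 200·d·log₂t·(log₂t + 21)∕t`. [folklore] -/
theorem abs_integral_zigzag_l1Norm_sub_le_of_moments {P₁ P₂ : Measure (ι → ℝ)} [IsProbabilityMeasure P₁] [IsProbabilityMeasure P₂]
    (hP₁ : P₁ (Set.pi Set.univ (fun _ : ι => Set.Icc (-1 : ℝ) 1))ᶜ = 0) (hP₂ : P₂ (Set.pi Set.univ (fun _ : ι => Set.Icc (-1 : ℝ) 1))ᶜ = 0)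
    {t : ℕ} (ht : 256 ≤ t) (hmom : ∀ j : ι → ℕ, ∑ i, j i ≤ t → ∫ x, ∏ i, x i ^ j i ∂P₁ = ∫ x, ∏ i, x i ^ j i ∂P₂)
    {P : ℝ} (hP : 0 < P) (hP2 : P ≤ 2 * Fintype.card ι) :
    |∫ x, P / (2 * π) * Real.arccos (Real.cos (2 * π * (∑ i, |x i|) / P)) ∂P₁ -
        ∫ x, P / (2 * π) * Real.arccos (Real.cos (2 * π * (∑ i, |x i|) / P)) ∂P₂| ≤
      200 * Fintype.card ι * Real.logb 2 t * (Real.logb 2 t + 21) / t := by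
  obtain ⟨F, hF, happ⟩ := exists_mvPolynomial_near_zigzag_l1Norm_degree (ι := ι) ht hP hP2
  have hg : Continuous fun x : ι → ℝ => P / (2 * π) * Real.arccos (Real.cos (2 * π * (∑ i, |x i|) / P)) :=
    continuous_const.mul (Real.continuous_arccos.comp (Real.continuous_cos.comp
      ((continuous_const.mul continuous_l1Norm).div_const _)))
  have h := abs_integral_sub_integral_le_of_near hP₁ hP₂ hmom hg hF happ
  refine h.trans_eq ?_
  ring

end Summit.QuantumFields.YangMills.Theorems.BalabanUVNodesN19ZigzagLinksDegreeBudget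

end
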